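import Summits.Parity.BatemanHorn.Theorems.AlmostPrimeZerosDefs
import Literature.NumberTheory.Sieve.BatemanHornProofs
import HarnessLib

/-!
# Route `AlmostPrimeZeros`, crux `SystemLSDRealSegment` (stmt-Parity-11292), line
# `beta-thinned-root-kernel`: local estimates for the explicit Euler factor (helper of `stub_eulerFactor`)

Counting at one prime `p` for a family `f = (fᵢ) : Fin k → ℤ[X]`, with the capped exponent
`e(n) = Σᵢ localExp p (fᵢ(n)) ∈ {0, …, 2k}` of `Summits/Parity/BatemanHorn/Theorems/AlmostPrimeZerosDefs.lean`:

* `#{n < p² : p ∣ ∏ᵢ fᵢ(n)} = p · ω_f(p)` for EVERY `p` (the predicate is `p`-periodic);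
* hence the EXACT identity `p² E_p(z) = p² + p ω_f(p) (z − 1) + Σ_{n < p²} (z^{e(n)} − z^{min(e(n),1)})`
  for the local factor `E_p = localFactor f p`, and `E_p(0) = 1 − ω_f(p)/p`;
* under the local counts of a Bateman–Horn system at a large prime (no common roots of two members
  modulo `p`, Hensel count `#{n < p² : p² ∣ fᵢ(n)} ≤ deg fᵢ`): `#{n < p² : e(n) ≥ 2} ≤ D := Σ deg fᵢ`,
  `ω_f(p) ≤ D`, and `‖E_p(z) − 1 − (z − 1) ω_f(p)/p‖ ≤ D (4^k + 2) / p²` for `‖z‖ ≤ 2`.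

These feed the uniform convergence of the ordered Euler product `eulerFactor f` on `|z| < 2`
(`AlmostPrimeZerosSystemLSDRealSegmentEulerFactor.lean`, which imports this file).
-/

open Filter Finset Polynomial
open scoped BigOperators Topology

namespace Summit.Parity.BatemanHorn.Cruxes.SystemLSDRealSegment.BetaThinnedRootKernel

open Literature.NumberTheory.Sieve

/-! ### The capped local exponent -/

/-- `localExp p m ≤ 2`. [folklore] -/
theorem localExp_le_two (p : ℕ) (m : ℤ) : localExp p m ≤ 2 := by
  unfold localExp
  split_ifs <;> omega

/-- `localExp p m = 0 ↔ p ∤ m`. [folklore] -/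
theorem localExp_eq_zero_iff (p : ℕ) (m : ℤ) : localExp p m = 0 ↔ ¬ (p : ℤ) ∣ m := by
  unfold localExp
  split_ifs with h2 h1
  · have h : (p : ℤ) ∣ m := (dvd_pow_self (p : ℤ) two_ne_zero).trans h2
    simp [h]
  · simp [h1]
  · simp [h1]

/-- If `p² ∤ m` then `localExp p m = [p ∣ m]`. [folklore] -/
theorem localExp_of_not_sq_dvd {p : ℕ} {m : ℤ} (h : ¬ (p : ℤ) ^ 2 ∣ m) :
    localExp p m = if (p : ℤ) ∣ m then 1 else 0 := by
  unfold localExp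
  rw [if_neg h]

variable {k : ℕ} (f : Fin k → ℤ[X])

/-- `e(n) = Σᵢ localExp p (fᵢ(n)) ≤ 2k`. [folklore] -/
theorem sum_localExp_le (p : ℕ) (n : ℤ) : ∑ i, localExp p ((f i).eval n) ≤ 2 * k :=
  calc ∑ i, localExp p ((f i).eval n) ≤ ∑ _i : Fin k, 2 :=
        Finset.sum_le_sum fun i _ => localExp_le_two p _
    _ = 2 * k := by simp [mul_comm]

/-- `e(n) = 0 ↔ p ∤ ∏ᵢ fᵢ(n)` (`p` prime). [folklore] -/
theorem sum_localExp_eq_zero_iff {p : ℕ} (hp : p.Prime) (n : ℤ) :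
    ∑ i, localExp p ((f i).eval n) = 0 ↔ ¬ (p : ℤ) ∣ ∏ i, (f i).eval n := by
  rw [Finset.sum_eq_zero_iff, (Nat.prime_iff_prime_int.mp hp).dvd_finsetProd_iff]
  simp [localExp_eq_zero_iff]

/-! ### Counting modulo `p²` -/

/-- A predicate of period `a` holds `m · #{j < a : P j}` times below `m a`. [folklore] -/
theorem card_filter_range_mul_of_periodic (P : ℕ → Prop) [DecidablePred P] {a : ℕ}
    (hP : Function.Periodic P a) :
    ∀ m : ℕ, #((range (m * a)).filter P) = m * #((range a).filter P)
  | 0 => by simp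
  | m + 1 => by
    have hsplit : range ((m + 1) * a) = range (m * a) ∪ Ico (m * a) (m * a + a) := by
      rw [range_eq_Ico, range_eq_Ico, add_one_mul,
        Ico_union_Ico_eq_Ico (Nat.zero_le _) (Nat.le_add_right _ _)]
    have hdisj : Disjoint ((range (m * a)).filter P) ((Ico (m * a) (m * a + a)).filter P) :=
      disjoint_filter_filter (by rw [range_eq_Ico]; exact Ico_disjoint_Ico_consecutive 0 _ _)
    rw [hsplit, filter_union, card_union_of_disjoint hdisj, card_filter_range_mul_of_periodic P hP m,
      Nat.filter_Ico_card_eq_of_periodic (m * a) a P hP, Nat.count_eq_card_filter_range, add_one_mul]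

/-- `#{n < p² : p ∣ ∏ᵢ fᵢ(n)} = p · ω_f(p)` (the predicate is `p`-periodic in `n`). [folklore] -/
theorem card_filter_dvd_prod_eval_sq (p : ℕ) :
    #((range (p ^ 2)).filter fun n : ℕ => (p : ℤ) ∣ ∏ i, (f i).eval (n : ℤ)) =
      p * polyRootCountMod f p := by
  have hper : Function.Periodic (fun n : ℕ => (p : ℤ) ∣ ∏ i, (f i).eval (n : ℤ)) p := by
    intro n
    simp only [eq_iff_iff, ← Polynomial.eval_prod]
    refine dvd_iff_dvd_of_dvd_sub ?_
    have h := Polynomial.sub_dvd_eval_sub ((n + p : ℕ) : ℤ) (n : ℤ) (∏ i, f i)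
    rwa [show ((n + p : ℕ) : ℤ) - (n : ℤ) = p by omega] at h
  rw [sq, card_filter_range_mul_of_periodic _ hper p]
  rfl

/-- `Σ_{n < p²} z^{min(e(n),1)} = p² + p ω_f(p) (z − 1)` (`p` prime). [folklore] -/
theorem sum_pow_min_one_eq {p : ℕ} (hp : p.Prime) (z : ℂ) :
    ∑ n ∈ range (p ^ 2), z ^ min (∑ i, localExp p ((f i).eval (n : ℤ))) 1 =
      (p : ℂ) ^ 2 + (p : ℂ) * (polyRootCountMod f p) * (z - 1) := by
  have key : ∀ n : ℕ, z ^ min (∑ i, localExp p ((f i).eval (n : ℤ))) 1 =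
      1 + if (p : ℤ) ∣ ∏ i, (f i).eval (n : ℤ) then z - 1 else 0 := by
    intro n
    by_cases h : (p : ℤ) ∣ ∏ i, (f i).eval (n : ℤ)
    · have h0 : ∑ i, localExp p ((f i).eval (n : ℤ)) ≠ 0 :=
        fun h0 => (sum_localExp_eq_zero_iff f hp n).mp h0 h
      rw [if_pos h, min_eq_right (Nat.one_le_iff_ne_zero.mpr h0), pow_one]
      ring
    · rw [if_neg h, (sum_localExp_eq_zero_iff f hp _).mpr h]
      simp
  rw [Finset.sum_congr rfl fun n _ => key n, Finset.sum_add_distrib, sum_const, card_range,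
    ← Finset.sum_filter, sum_const, card_filter_dvd_prod_eval_sq]
  simp only [nsmul_eq_mul, Nat.cast_pow, Nat.cast_mul]
  ring

/-- The EXACT local identity: `E_p(z) = 1 + (z − 1) ω_f(p)/p + p⁻² Σ_{n<p²} (z^{e(n)} − z^{min(e(n),1)})`
(`p` prime). [folklore] -/
theorem localFactor_eq {p : ℕ} (hp : p.Prime) (z : ℂ) :
    localFactor f p z = 1 + (z - 1) * (polyRootCountMod f p : ℂ) / p +
      ((p : ℂ) ^ 2)⁻¹ * ∑ n ∈ range (p ^ 2),
        (z ^ (∑ i, localExp p ((f i).eval (n : ℤ))) -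
          z ^ min (∑ i, localExp p ((f i).eval (n : ℤ))) 1) := by
  have hp0 : (p : ℂ) ≠ 0 := by exact_mod_cast hp.ne_zero
  unfold localFactor
  rw [Finset.sum_sub_distrib, sum_pow_min_one_eq f hp z]
  field_simp
  ring

/-- `E_p(0) = 1 − ω_f(p)/p` (`p` prime). [folklore] -/
theorem localFactor_zero {p : ℕ} (hp : p.Prime) :
    localFactor f p 0 = 1 - (polyRootCountMod f p : ℂ) / p := by
  rw [localFactor_eq f hp 0]
  have h : ∀ n ∈ range (p ^ 2), (0 : ℂ) ^ (∑ i, localExp p ((f i).eval (n : ℤ))) -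
      0 ^ min (∑ i, localExp p ((f i).eval (n : ℤ))) 1 = 0 := by
    intro n _
    rcases Nat.eq_zero_or_pos (∑ i, localExp p ((f i).eval (n : ℤ))) with h0 | h0
    · rw [h0]
      simp
    · rw [zero_pow h0.ne', min_eq_right h0, pow_one, sub_zero]
  rw [Finset.sum_eq_zero h]
  ring

/-! ### Bounds at a large prime -/

/-- `‖z^m − z^{min(m,1)}‖ ≤ (4^k + 2)·[2 ≤ m]` for `‖z‖ ≤ 2`, `m ≤ 2k`. [folklore] -/
theorem norm_pow_sub_pow_min_le {z : ℂ} (hz : ‖z‖ ≤ 2) {m : ℕ} (hm : m ≤ 2 * k) :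
    ‖z ^ m - z ^ min m 1‖ ≤ if 2 ≤ m then (4 : ℝ) ^ k + 2 else 0 := by
  split_ifs with h2
  · calc ‖z ^ m - z ^ min m 1‖ ≤ ‖z ^ m‖ + ‖z ^ min m 1‖ := norm_sub_le _ _
      _ ≤ 2 ^ m + 2 ^ 1 := by
          rw [norm_pow, norm_pow, min_eq_right (by omega : 1 ≤ m)]
          gcongr
      _ ≤ 2 ^ (2 * k) + 2 := by
          gcongr
          · norm_num
          · norm_num
      _ = 4 ^ k + 2 := by rw [pow_mul]; norm_num
  · have hm1 : m ≤ 1 := by omega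
    interval_cases m <;> simp

/-- `‖Σ_{n<p²} (z^{e(n)} − z^{min(e(n),1)})‖ ≤ #{n < p² : e(n) ≥ 2} · (4^k + 2)` for `‖z‖ ≤ 2`.
[folklore] -/
theorem norm_sum_pow_sub_pow_min_le (p : ℕ) {z : ℂ} (hz : ‖z‖ ≤ 2) :
    ‖∑ n ∈ range (p ^ 2), (z ^ (∑ i, localExp p ((f i).eval (n : ℤ))) -
        z ^ min (∑ i, localExp p ((f i).eval (n : ℤ))) 1)‖ ≤
      #((range (p ^ 2)).filter fun n : ℕ => 2 ≤ ∑ i, localExp p ((f i).eval (n : ℤ))) *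
        ((4 : ℝ) ^ k + 2) := by
  calc _ ≤ ∑ n ∈ range (p ^ 2), ‖z ^ (∑ i, localExp p ((f i).eval (n : ℤ))) -
        z ^ min (∑ i, localExp p ((f i).eval (n : ℤ))) 1‖ := norm_sum_le _ _
    _ ≤ ∑ n ∈ range (p ^ 2),
        (if 2 ≤ ∑ i, localExp p ((f i).eval (n : ℤ)) then (4 : ℝ) ^ k + 2 else 0) :=
        Finset.sum_le_sum fun n _ => norm_pow_sub_pow_min_le hz (sum_localExp_le f p n)
    _ = _ := by
        rw [Finset.sum_ite, Finset.sum_const_zero, add_zero, Finset.sum_const, nsmul_eq_mul]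

/-- No common roots modulo `p` + Hensel count ⇒ `#{n < p² : e(n) ≥ 2} ≤ Σ deg fᵢ`. [folklore] -/
theorem card_filter_two_le_sum_localExp_le {p : ℕ}
    (h2 : ∀ i j, i ≠ j → ∀ n : ℤ, ¬ ((p : ℤ) ∣ (f i).eval n ∧ (p : ℤ) ∣ (f j).eval n))
    (h3 : ∀ i, #((range (p ^ 2)).filter fun n : ℕ => ((p : ℤ) ^ 2) ∣ (f i).eval (n : ℤ)) ≤
      (f i).natDegree) :
    #((range (p ^ 2)).filter fun n : ℕ => 2 ≤ ∑ i, localExp p ((f i).eval (n : ℤ))) ≤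
      ∑ i, (f i).natDegree := by
  classical
  have hsub : ((range (p ^ 2)).filter fun n : ℕ => 2 ≤ ∑ i, localExp p ((f i).eval (n : ℤ))) ⊆
      (univ : Finset (Fin k)).biUnion fun i =>
        (range (p ^ 2)).filter fun n : ℕ => ((p : ℤ) ^ 2) ∣ (f i).eval (n : ℤ) := by
    intro n hn
    rw [mem_filter] at hn
    rw [mem_biUnion]
    by_contra hcon
    have hnsq : ∀ i, ¬ ((p : ℤ) ^ 2 ∣ (f i).eval (n : ℤ)) :=
      fun i hi => hcon ⟨i, mem_univ i, mem_filter.mpr ⟨hn.1, hi⟩⟩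
    have he : ∑ i, localExp p ((f i).eval (n : ℤ)) =
        #(univ.filter fun i => (p : ℤ) ∣ (f i).eval (n : ℤ)) := by
      rw [Finset.sum_congr rfl fun i _ => localExp_of_not_sq_dvd (hnsq i), Finset.sum_boole,
        Nat.cast_id]
    have hle : #(univ.filter fun i => (p : ℤ) ∣ (f i).eval (n : ℤ)) ≤ 1 := by
      refine Finset.card_le_one.mpr fun i hi j hj => ?_
      by_contra hij
      rw [mem_filter] at hi hj
      exact h2 i j hij n ⟨hi.2, hj.2⟩
    omega
  calc _ ≤ #((univ : Finset (Fin k)).biUnion fun i =>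
        (range (p ^ 2)).filter fun n : ℕ => ((p : ℤ) ^ 2) ∣ (f i).eval (n : ℤ)) := card_le_card hsub
    _ ≤ ∑ i, #((range (p ^ 2)).filter fun n : ℕ => ((p : ℤ) ^ 2) ∣ (f i).eval (n : ℤ)) :=
        card_biUnion_le
    _ ≤ ∑ i, (f i).natDegree := Finset.sum_le_sum fun i _ => h3 i

/-- Union bound + Lagrange: `ω_f(p) ≤ Σ deg fᵢ` at a prime `p ∤ lc fᵢ`. [folklore] -/
theorem polyRootCountMod_le_sum_natDegree {p : ℕ} (hp : p.Prime)
    (h1 : ∀ i, ¬ (p : ℤ) ∣ (f i).leadingCoeff) :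
    polyRootCountMod f p ≤ ∑ i, (f i).natDegree := by
  classical
  have hset : ((range p).filter fun n : ℕ => (p : ℤ) ∣ ∏ i, (f i).eval (n : ℤ)) =
      (univ : Finset (Fin k)).biUnion fun i =>
        (range p).filter fun n : ℕ => (p : ℤ) ∣ (f i).eval (n : ℤ) := by
    ext n
    simp only [mem_filter, mem_biUnion, mem_univ, true_and]
    rw [(Nat.prime_iff_prime_int.mp hp).dvd_finsetProd_iff]
    simp
  unfold polyRootCountMod
  rw [hset]
  calc _ ≤ ∑ i, #((range p).filter fun n : ℕ => (p : ℤ) ∣ (f i).eval (n : ℤ)) := card_biUnion_le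
    _ ≤ ∑ i, (f i).natDegree := Finset.sum_le_sum fun i _ => by
        rw [← polyRootCountMod_single]
        exact polyRootCountMod_single_le_natDegree hp (h1 i)

/-- **Local estimate at a large prime.** No common roots modulo `p` + Hensel count ⇒
`‖E_p(z) − (1 + (z − 1) ω_f(p)/p)‖ ≤ (Σ deg fᵢ)(4^k + 2)/p²` for `‖z‖ ≤ 2`. [folklore] -/
theorem norm_localFactor_sub_le {p : ℕ} (hp : p.Prime)
    (h2 : ∀ i j, i ≠ j → ∀ n : ℤ, ¬ ((p : ℤ) ∣ (f i).eval n ∧ (p : ℤ) ∣ (f j).eval n))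
    (h3 : ∀ i, #((range (p ^ 2)).filter fun n : ℕ => ((p : ℤ) ^ 2) ∣ (f i).eval (n : ℤ)) ≤
      (f i).natDegree) {z : ℂ} (hz : ‖z‖ ≤ 2) :
    ‖localFactor f p z - (1 + (z - 1) * (polyRootCountMod f p : ℂ) / p)‖ ≤
      (∑ i, (f i).natDegree : ℕ) * ((4 : ℝ) ^ k + 2) / (p : ℝ) ^ 2 := by
  rw [localFactor_eq f hp z, add_sub_cancel_left, norm_mul, norm_inv, norm_pow, Complex.norm_natCast]
  have hp0 : (0 : ℝ) < (p : ℝ) ^ 2 := by have := hp.pos; positivity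
  rw [inv_mul_eq_div, div_le_div_iff_of_pos_right hp0]
  calc _ ≤ #((range (p ^ 2)).filter fun n : ℕ => 2 ≤ ∑ i, localExp p ((f i).eval (n : ℤ))) *
        ((4 : ℝ) ^ k + 2) := norm_sum_pow_sub_pow_min_le f p hz
    _ ≤ _ := by
        gcongr
        exact_mod_cast card_filter_two_le_sum_localExp_le f h2 h3

/-! ### The helper statement by name -/

/-- **eulerFactorAux_localEstimate** (registered helper sub-goal of `stub_eulerFactor`, line
`beta-thinned-root-kernel`): at a prime `p` where no two members of `f` have a common root modulo `p` and
the Hensel count `#{n < p² : p² ∣ fᵢ(n)} ≤ deg fᵢ` holds, the local tilted mean satisfies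
`‖E_p(z) − (1 + (z − 1) ω_f(p)/p)‖ ≤ (Σ deg fᵢ)(4^k + 2)/p²` for `‖z‖ ≤ 2`. [folklore] -/
theorem eulerFactorAux_localEstimate : ∀ (k : ℕ) (f : Fin k → ℤ[X]) (p : ℕ), p.Prime →
    (∀ i j, i ≠ j → ∀ n : ℤ, ¬ ((p : ℤ) ∣ (f i).eval n ∧ (p : ℤ) ∣ (f j).eval n)) →
    (∀ i, #((range (p ^ 2)).filter fun n : ℕ => ((p : ℤ) ^ 2) ∣ (f i).eval (n : ℤ)) ≤ (f i).natDegree) →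
    ∀ z : ℂ, ‖z‖ ≤ 2 →
      ‖localFactor f p z - (1 + (z - 1) * (polyRootCountMod f p : ℂ) / p)‖ ≤
        (∑ i, (f i).natDegree : ℕ) * ((4 : ℝ) ^ k + 2) / (p : ℝ) ^ 2 :=
  fun _ f _ hp h2 h3 _ hz => norm_localFactor_sub_le f hp h2 h3 hz

end Summit.Parity.BatemanHorn.Cruxes.SystemLSDRealSegment.BetaThinnedRootKernel
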